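import Mathlib
import Literature.AlgebraicGeometry.Resolution.QuadraticTransformsRegular
import Literature.AlgebraicGeometry.Resolution.SymbolicPowersRsop
import HarnessLib

/-!
# Route `RadicialJung`, crux `CleanModels` (stmt-15917), stub `stub_cleanLU3DefectNonDiscrete`, sub-line (C): the chart of the blow-up of a
# regular local ring along the CURVE cut out by two regular parameters is regular (piece G3′ of the lead's brief `Lines/Sketch-brief-Cdiv-subline.md`)

Line `Sketch` rev 24 of crux stmt-ResolutionOfSingularities-15917; lead `res-B-lead-1` g3.  OURS; nothing here proves resolution in
characteristic `p`.  For a regular local subring `R ⊆ K` with regular system of parameters `x`, and two indices `i ≠ j`, the ring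
`R[x_i/x_j] ⊆ K` — the chart «`x_j ≠ 0`» of the blowing up of `Spec R` along the regular centre `V(x_i, x_j)` — is a REGULAR ring, and its
local ring at the centre of any valuation ring `O ⊇ R` with `v(x_i) ≤ v(x_j)` is a regular local ring.  This is the Literature's de Jong F6
node (`BlowupChartRegular.lean`: the chart of a blow-up along a quasi-regular sequence with regular quotient is regular; a sub-family of a
regular system of parameters is quasi-regular, `SymbolicPowersRsop.lean`) transported into `K` by `isRegularRing_closure_of_isRegularRing_blowupChart`
(`QuadraticTransformsRegular.lean`, there used for POINT blow-ups).  Used by the composite sub-line to lift loose clean form (1) from the residue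
surface `E = {t = 0}` by blowing up the curves `{t = t₂ = 0}`, `{t = t₃ = 0}`.

* `isRegularRing_curveChart` — `R[x_i/x_j]` is a regular ring.
* `curveChart_le` — `R[x_i/x_j] ⊆ O` when `v(x_i) ≤ v(x_j)`.
* `isRegularLocalRing_locAtCentre_curveChart` — its local ring at the centre of `O` is regular local.
* `exists_eq_add_mul_of_mem_closure`, `maximalIdeal_locAtCentre_curveChart` — when `v(x_i) < v(x_j)` and `O` dominates `R`, the maximal ideal of
  `locAtCentre R[x_i/x_j] O` is generated by `x_i/x_j` and the `x_m`, `m ≠ i` (the regular system of parameters of the chart).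
-/

noncomputable section

set_option linter.dupNamespace false -- mandated namespace of this single-conjunct summit

open IsLocalRing
open Literature.AlgebraicGeometry.Resolution

namespace Summit.ResolutionOfSingularities.ResolutionOfSingularities.Theorems.RadicialJung.CleanModels

variable {K : Type} [Field K]

/-- **The curve chart `R[x_i/x_j]` is a regular ring** (`x` a regular system of parameters of the regular local subring `R ⊆ K`, `i ≠ j`):
the blow-up of `Spec R` along `V(x_i, x_j)`, chart `x_j ≠ 0`. [folklore] -/
theorem isRegularRing_curveChart (R : Subring K) [IsRegularLocalRing R] {d : ℕ}
    (hd : (maximalIdeal R).spanFinrank = d) (x : Fin d → R) (hx : Ideal.span (Set.range x) = maximalIdeal R)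
    (i j : Fin d) (hij : i ≠ j) :
    IsRegularRing (Subring.closure ((R : Set K) ∪ {((x i : R) : K) / ((x j : R) : K)})) := by
  classical
  -- the sub-family `(x_i, x_j)` of the regular system of parameters
  set S : Finset (Fin d) := {i, j} with hS
  have hcard : S.card = 2 := Finset.card_pair hij
  set e : Fin 2 ↪o Fin d := S.orderEmbOfFin hcard with he
  have herange : Set.range e = (S : Set (Fin d)) := by rw [he, Finset.range_orderEmbOfFin]
  have heinj : Function.Injective e := e.injective
  -- the denominator index `k` with `e k = j`
  have hjS : j ∈ Set.range e := by rw [herange, hS]; simp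
  obtain ⟨k, hk⟩ := hjS
  -- quasi-regularity and regularity of the quotient
  have hq : IsQuasiRegular (x ∘ e) := isQuasiRegular_rsop_comp hd x hx e heinj
  haveI : IsRegularRing R := isRegularRing_of_isRegularLocalRing R
  have hrange : Set.range (x ∘ e) = x '' (S : Set (Fin d)) := by rw [Set.range_comp, herange]
  haveI : IsRegularRing (R ⧸ Ideal.span (Set.range (x ∘ e))) := by
    rw [hrange]
    haveI := isRegularLocalRing_quotient_span_image hd x hx S
    exact isRegularRing_of_isRegularLocalRing _
  have hB := isRegularRing_blowupChart (x ∘ e) k hq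
  -- `x_j ≠ 0`
  have hxj : x j ≠ 0 := by
    intro h
    have := not_mem_span_image_of_not_mem hd x hx (S := ∅) (i := j) (Set.notMem_empty j)
    rw [Set.image_empty, Ideal.span_empty, h] at this
    exact this (Submodule.zero_mem ⊥)
  have hxk : R.subtype ((x ∘ e) k) ≠ 0 := by
    rw [Function.comp_apply, hk]
    exact fun h => hxj (Subtype.ext h)
  have hreg := isRegularRing_closure_of_isRegularRing_blowupChart R.subtype (x ∘ e) k Subtype.val_injective hxk hB
  -- the two closures agree: the generators are `x_i/x_j` and `x_j/x_j = 1`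
  have hset : Subring.closure ((R.subtype.range : Set K) ∪ Set.range fun m => R.subtype ((x ∘ e) m) / R.subtype ((x ∘ e) k)) =
      Subring.closure ((R : Set K) ∪ {((x i : R) : K) / ((x j : R) : K)}) := by
    have hxj0 : ((x j : R) : K) ≠ 0 := fun h => hxj (Subtype.ext h)
    apply le_antisymm
    · refine Subring.closure_le.mpr ?_
      rintro z (⟨r, rfl⟩ | ⟨m, rfl⟩)
      · exact Subring.subset_closure (Or.inl r.2)
      · have hm : e m ∈ (S : Set (Fin d)) := by rw [← herange]; exact ⟨m, rfl⟩
        rw [hS, Finset.coe_insert, Finset.coe_singleton, Set.mem_insert_iff, Set.mem_singleton_iff] at hm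
        change ((x (e m) : R) : K) / ((x (e k) : R) : K) ∈ _
        rw [hk]
        rcases hm with hm | hm
        · rw [hm]; exact Subring.subset_closure (Or.inr rfl)
        · rw [hm, div_self hxj0]; exact Subring.one_mem _
    · refine Subring.closure_le.mpr ?_
      rintro z (hz | rfl)
      · exact Subring.subset_closure (Or.inl ⟨⟨z, hz⟩, rfl⟩)
      · have hiS : i ∈ Set.range e := by rw [herange, hS]; simp
        obtain ⟨m, hm⟩ := hiS
        refine Subring.subset_closure (Or.inr ⟨m, ?_⟩)
        change ((x (e m) : R) : K) / ((x (e k) : R) : K) = _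
        rw [hm, hk]
  rw [hset] at hreg
  exact hreg

/-- `R[x_i/x_j] ⊆ O` when `R ⊆ O` and `v(x_i) ≤ v(x_j)`. [folklore] -/
theorem curveChart_le (O : ValuationSubring K) (R : Subring K) (hRO : R ≤ O.toSubring) (a b : K)
    (hv : O.valuation a ≤ O.valuation b) :
    Subring.closure ((R : Set K) ∪ {a / b}) ≤ O.toSubring := by
  refine Subring.closure_le.mpr ?_
  rintro z (hz | rfl)
  · exact hRO hz
  · change a / b ∈ O
    rw [← O.valuation_le_one_iff, map_div₀]
    exact div_le_one_of_le₀ hv zero_le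

/-- **The local ring of the curve chart at the centre of a valuation is regular local**: for `R ⊆ O` regular local with regular system
of parameters `x`, `i ≠ j`, `v(x_i) ≤ v(x_j)`, the ring `locAtCentre R[x_i/x_j] O` is a regular local ring dominated by `O`. [folklore] -/
theorem isRegularLocalRing_locAtCentre_curveChart (O : ValuationSubring K) (R : Subring K) [IsRegularLocalRing R]
    (hRO : R ≤ O.toSubring) {d : ℕ} (hd : (maximalIdeal R).spanFinrank = d) (x : Fin d → R)
    (hx : Ideal.span (Set.range x) = maximalIdeal R) (i j : Fin d) (hij : i ≠ j)
    (hv : O.valuation ((x i : R) : K) ≤ O.valuation ((x j : R) : K)) :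
    IsRegularLocalRing (locAtCentre (Subring.closure ((R : Set K) ∪ {((x i : R) : K) / ((x j : R) : K)})) O) ∧
      SubringDominates (locAtCentre (Subring.closure ((R : Set K) ∪ {((x i : R) : K) / ((x j : R) : K)})) O) O.toSubring := by
  have hle := curveChart_le O R hRO _ _ hv
  haveI := isRegularRing_curveChart R hd x hx i j hij
  exact ⟨isRegularLocalRing_locAtCentre_of_isRegularRing hle, subringDominates_locAtCentre hle⟩


/-- **Elements of `R[q]` are `r + q · b`** with `r ∈ R`, `b ∈ R[q]`. [folklore] -/
theorem exists_eq_add_mul_of_mem_closure (R : Subring K) (q : K) {y : K}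
    (hy : y ∈ Subring.closure ((R : Set K) ∪ {q})) :
    ∃ r : K, r ∈ R ∧ ∃ b : K, b ∈ Subring.closure ((R : Set K) ∪ {q}) ∧ y = r + q * b := by
  set B := Subring.closure ((R : Set K) ∪ {q}) with hB
  have hRB : ∀ r : K, r ∈ R → r ∈ B := fun r hr => Subring.subset_closure (Or.inl hr)
  have hqB : q ∈ B := Subring.subset_closure (Or.inr rfl)
  induction hy using Subring.closure_induction with
  | mem z hz =>
    rcases hz with hz | rfl
    · exact ⟨z, hz, 0, B.zero_mem, by ring⟩
    · exact ⟨0, R.zero_mem, 1, B.one_mem, by ring⟩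
  | zero => exact ⟨0, R.zero_mem, 0, B.zero_mem, by ring⟩
  | one => exact ⟨1, R.one_mem, 0, B.zero_mem, by ring⟩
  | add a c _ _ ha hc =>
    obtain ⟨r₁, hr₁, b₁, hb₁, rfl⟩ := ha
    obtain ⟨r₂, hr₂, b₂, hb₂, rfl⟩ := hc
    exact ⟨r₁ + r₂, R.add_mem hr₁ hr₂, b₁ + b₂, B.add_mem hb₁ hb₂, by ring⟩
  | neg a _ ha =>
    obtain ⟨r₁, hr₁, b₁, hb₁, rfl⟩ := ha
    exact ⟨-r₁, R.neg_mem hr₁, -b₁, B.neg_mem hb₁, by ring⟩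
  | mul a c _ _ ha hc =>
    obtain ⟨r₁, hr₁, b₁, hb₁, rfl⟩ := ha
    obtain ⟨r₂, hr₂, b₂, hb₂, rfl⟩ := hc
    refine ⟨r₁ * r₂, R.mul_mem hr₁ hr₂, b₁ * r₂ + r₁ * b₂ + q * b₁ * b₂, ?_, by ring⟩
    exact B.add_mem (B.add_mem (B.mul_mem hb₁ (hRB _ hr₂)) (B.mul_mem (hRB _ hr₁) hb₂))
      (B.mul_mem (B.mul_mem hqB hb₁) hb₂)

/-- **The regular system of parameters of the curve chart**: for `R ⊆ O` regular local dominated by `O`, with regular system of parameters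
`x`, `i ≠ j` and `v(x_i) < v(x_j)` (the chart containing the centre of `O`), the maximal ideal of `R′ = locAtCentre R[x_i/x_j] O` is generated by
`x_i/x_j` and the `x_m`, `m ≠ i` (so by `x_i/x_j, (x_m)_{m ≠ i}`: `x_i = (x_i/x_j) · x_j` is redundant). [folklore] -/
theorem maximalIdeal_locAtCentre_curveChart (O : ValuationSubring K) (R : Subring K) [IsRegularLocalRing R]
    (hRO : R ≤ O.toSubring) (hdom : SubringDominates R O.toSubring) {d : ℕ} (x : Fin d → R)
    (hx : Ideal.span (Set.range x) = maximalIdeal R) (i j : Fin d)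
    (hv : O.valuation ((x i : R) : K) < O.valuation ((x j : R) : K))
    (hq : ((x i : R) : K) / ((x j : R) : K) ∈ locAtCentre (Subring.closure ((R : Set K) ∪ {((x i : R) : K) / ((x j : R) : K)})) O)
    (hxm : ∀ m : Fin d, ((x m : R) : K) ∈ locAtCentre (Subring.closure ((R : Set K) ∪ {((x i : R) : K) / ((x j : R) : K)})) O) :
    (haveI := isLocalRing_locAtCentre (curveChart_le O R hRO _ _ hv.le);
      IsLocalRing.maximalIdeal (locAtCentre (Subring.closure ((R : Set K) ∪ {((x i : R) : K) / ((x j : R) : K)})) O)) =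
      Ideal.span (insert ⟨_, hq⟩ (Set.range fun m : {m : Fin d // m ≠ i} => ⟨_, hxm m⟩)) := by
  classical
  set q : K := ((x i : R) : K) / ((x j : R) : K) with hqdef
  set B := Subring.closure ((R : Set K) ∪ {q}) with hB
  have hBO : B ≤ O.toSubring := curveChart_le O R hRO _ _ hv.le
  haveI := isLocalRing_locAtCentre hBO
  set R' := locAtCentre B O with hR'
  have hxj0 : ((x j : R) : K) ≠ 0 := by
    intro h0; rw [h0, map_zero] at hv; exact not_lt.mpr zero_le hv
  have hvq : O.valuation q < 1 := by
    rw [hqdef, map_div₀, div_lt_one₀ (zero_lt_iff.mpr ((Valuation.ne_zero_iff _).mpr hxj0))]; exact hv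
  have hmemR : ∀ r : R, r ∈ maximalIdeal R ↔ O.valuation (r : K) < 1 :=
    (subringDominates_valuationSubring_iff hRO).mp hdom
  apply le_antisymm
  · -- `⊆`: write `z = y / w`, `y = r + q b`, `r = Σ c_m x_m`
    intro z hz
    have hvz : O.valuation (z : K) < 1 := (mem_maximalIdeal_locAtCentre_iff hBO z).mp hz
    obtain ⟨y, hy, w, hw, hvw, hzyw⟩ := (mem_locAtCentre_iff (B := B) (O := O)).mp z.2
    obtain ⟨r, hr, b, hb, hyrb⟩ := exists_eq_add_mul_of_mem_closure R q hy
    -- `v r < 1`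
    have hvy : O.valuation y < 1 := by
      have : (z : K) * w = y := by rw [hzyw, div_mul_cancel₀ _ (ne_zero_of_valuation_eq_one hvw)]
      rw [← this, map_mul, hvw, mul_one]; exact hvz
    have hvqb : O.valuation (q * b) < 1 := by
      rw [map_mul]
      calc O.valuation q * O.valuation b ≤ O.valuation q * 1 := by
            gcongr; exact (O.valuation_le_one_iff _).mpr (hBO hb)
        _ < 1 := by rw [mul_one]; exact hvq
    have hvr : O.valuation r < 1 := by
      have : r = y - q * b := by rw [hyrb]; ring
      rw [this]
      exact lt_of_le_of_lt (Valuation.map_sub _ _ _) (max_lt hvy hvqb)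
    have hrm : (⟨r, hr⟩ : R) ∈ maximalIdeal R := (hmemR ⟨r, hr⟩).mpr hvr
    rw [← hx, Ideal.mem_span_range_iff_exists_fun] at hrm
    obtain ⟨c, hc⟩ := hrm
    have hcK : (∑ m, ((c m : R) : K) * ((x m : R) : K)) = r := by
      have := congrArg (fun t : R => (t : K)) hc
      simpa using this
    -- membership of the pieces in `R'`
    have hBR' : B ≤ R' := le_locAtCentre B O
    have hRR' : ∀ t : K, t ∈ R → t ∈ R' := fun t ht => hBR' (Subring.subset_closure (Or.inl ht))
    have hwinv : w⁻¹ ∈ R' := inv_mem_locAtCentre (hBR' hw) hvw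
    -- the target ideal
    set J : Ideal R' := Ideal.span (insert ⟨q, hq⟩ (Set.range fun m : {m : Fin d // m ≠ i} => (⟨_, hxm m⟩ : R'))) with hJ
    have hqJ : (⟨q, hq⟩ : R') ∈ J := Ideal.subset_span (Set.mem_insert _ _)
    have hmJ : ∀ m : Fin d, m ≠ i → (⟨_, hxm m⟩ : R') ∈ J := fun m hm =>
      Ideal.subset_span (Set.mem_insert_of_mem _ ⟨⟨m, hm⟩, rfl⟩)
    -- every `x_m` lies in `J` (for `m = i`: `x_i = q x_j`)
    have hxJ : ∀ m : Fin d, (⟨_, hxm m⟩ : R') ∈ J := by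
      intro m
      by_cases hm : m = i
      · subst hm
        have : (⟨_, hxm m⟩ : R') = ⟨q, hq⟩ * ⟨_, hxm j⟩ := by
          apply Subtype.ext
          change ((x m : R) : K) = q * ((x j : R) : K)
          rw [hqdef, div_mul_cancel₀ _ hxj0]
        rw [this]
        exact J.mul_mem_right _ hqJ
      · exact hmJ m hm
    -- assemble: `z = w⁻¹ (Σ c_m x_m + q b)`
    have hzeq : z = ⟨w⁻¹, hwinv⟩ * (∑ m, ⟨_, hRR' _ (c m).2⟩ * ⟨_, hxm m⟩ + ⟨q, hq⟩ * ⟨b, hBR' hb⟩) := by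
      apply Subtype.ext
      change (z : K) = w⁻¹ * ((∑ m, (⟨_, hRR' _ (c m).2⟩ * ⟨_, hxm m⟩ : R') : R') + q * b)
      rw [AddSubmonoidClass.coe_finsetSum]
      change (z : K) = w⁻¹ * ((∑ m, ((c m : R) : K) * ((x m : R) : K)) + q * b)
      rw [hcK, ← hyrb, hzyw, div_eq_inv_mul]
    rw [hzeq]
    refine J.mul_mem_left _ (J.add_mem (J.sum_mem fun m _ => J.mul_mem_left _ (hxJ m)) (J.mul_mem_right _ hqJ))
  · -- `⊇`: the generators have value `< 1`
    rw [Ideal.span_le]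
    rintro g (rfl | ⟨m, rfl⟩)
    · exact (mem_maximalIdeal_locAtCentre_iff hBO _).mpr hvq
    · refine (mem_maximalIdeal_locAtCentre_iff hBO _).mpr ?_
      change O.valuation ((x (m : Fin d) : R) : K) < 1
      rw [← hmemR, ← hx]
      exact Ideal.subset_span ⟨(m : Fin d), rfl⟩

end Summit.ResolutionOfSingularities.ResolutionOfSingularities.Theorems.RadicialJung.CleanModels

end
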